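import Literature.NumberTheory.GaloisRepresentations.IdeleClassBarKSInvariant
import Literature.NumberTheory.GaloisRepresentations.IdeleClassBarInvariant
import Literature.Algebra.Homology.DiscreteRepInflationStages
import Literature.Algebra.Homology.CoinducedConjugation
import HarnessLib

/-!
# (★2) `inv_{K_S} = inv_K ∘ (Inf_{N_S}(–) ≫ incl)`: the invariant map of `(G_S, C_{K_S})` is the invariant map of
# `(Γ_K, C̄)` after inflation

Topic `NumberTheory/GaloisRepresentations`; namespace `Literature.NumberTheory.GaloisRepresentations.IdeleClassBar`.
For a number field `K` and a finite set `S` of finite places, `G_S = Γ_K ⧸ N_S`, `C_{K_S} = C̄^{N_S} ∈ C_{G_S}`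
(`classBarKSD K S`, -w3) with invariant map `invKS S : Ext²_{C_{G_S}}(ℤ, C_{K_S}) →+ ℚ/ℤ` (-w5, `IdeleClassBarKSInvariant`),
and `C̄ ∈ C_{Γ_K}` with invariant map `classBarInv K : Ext²_{C_{Γ_K}}(ℤ, C̄) →+ ℚ/ℤ` (door-c6, `IdeleClassBarInvariant`).

**Main result** `invKS_eq_classBarInv_inflExtHomTriv`: for every `x ∈ Ext²_{C_{G_S}}(ℤ, C_{K_S})`,

  `invKS S x = classBarInv K (Inf_{N_S}(x) ≫ incl)`,

where `Inf_{N_S} = DiscreteRep.inflExtHomTriv N_S` is inflation on `Ext` along `Γ_K ↠ G_S` (exact functor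
`inflQuotFunctor`) and `incl = classBarKSIncl S : Inf_{N_S} C_{K_S} ⟶ C̄` is the counit `C̄^{N_S} ⊆ C̄`.  Proof: `x` is
inflated from a layer `E ⊂ K_S` (door-c4's exhaustion); by INFLATION IN STAGES (`DiscreteRepInflationStages`) the class
`Inf_{N_S}(Inf_{V̄_E} c) ≫ incl` is door-c4's inflation from the layer `U_E = Gal(K̄/E)` of `Γ_K` of the pull-back
`H²(θ, ψ) c`, `θ : Γ_K ⧸ U_E → G_S ⧸ V̄_E`; both invariant maps then read `inv_{E/K}` of a class of `H²(Gal(E/K), C_E)`, and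
the two classes agree because the two dictionaries `H²(Γ_K⧸U_E, C̄^{U_E}) ≅ H²(Gal(E/K), C_E) ≅ H²(G_S⧸V̄_E, C_{K_S}^{V̄_E})`
are `groupCohomology.map` along compatible pairs (`layerCohomologyIso_hom_map_layerStage`).

This is step (★2) of the `(R4)_S` comparison for the Poitou–Tate `Ext` road at finite `S` (crux
`stmt-BirchSwinnertonDyer-19032`, lane PT-Ш-S-TC, brick D4b; -w6 g11 `F2D-SCOPING` §2(c)).  HONEST FRAMING: a compatibility of
invariant maps; no case of Poitou–Tate duality or of BSD is proved here.

## References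
* D. Harari, *Galois Cohomology and Class Field Theory*, Universitext (2020), §16.1 Definition 16.3 (the invariant map as a
  limit of layer invariants), §17.1 Theorem 17.2 (`(G_S, C_{K_S})`). [Harari2020]
* J. W. S. Cassels, A. Fröhlich (eds.), *Algebraic Number Theory* (1967), Ch. VII §11.2 (bis) (compatibility of `inv` with
  inflation). [CasselsFrohlichANT1967]
* J. S. Milne, *Arithmetic Duality Theorems*, 2nd ed. (2006), I §4 (p. 55: `P`-class formations `(G_S, C_S)`). [MilneADT2006]
* J.-P. Serre, *Galois Cohomology* (1997), I §2.2 Proposition 8. [SerreGaloisCohomology1997]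
-/

noncomputable section

open CategoryTheory CategoryTheory.Abelian
open IsDedekindDomain NumberField
open Field (absoluteGaloisGroup)
open Literature.NumberTheory.Automorphic Literature.NumberTheory.Automorphic.IdeleClassGroup
open Literature.NumberTheory.NumberFields
open Literature.Algebra.Homology Literature.Algebra.Homology.DiscreteRep
open Literature.NumberTheory.GaloisRepresentations.LocalWeilDatum (galFixing)
open scoped Classical

namespace Literature.NumberTheory.GaloisRepresentations

namespace IdeleClassBar

variable {K : Type} [Field K] [NumberField K] (S : Finset (HeightOneSpectrum (𝓞 K)))

/-! ## §1. The counit `Inf_{N_S} C_{K_S} ⟶ C̄` and the layer stage maps -/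

/-- **The counit `incl : Inf_{N_S} C_{K_S} ⟶ C̄`** in `C_{Γ_K}` (`C_{K_S} = C̄^{N_S} ⊆ C̄`, `x ↦ x`).
[cite: Harari2020, §17.1 Thm. 17.2][cite: MilneADT2006, I §4 (p. 55)] -/
def classBarKSIncl :
    (inflQuotFunctor ℤ (ramificationSubgroup K (↑S : Set (HeightOneSpectrum (𝓞 K))))).obj (classBarKSD K S) ⟶
      classBarD K :=
  invariantsInclQuot (ramificationSubgroup K (↑S : Set (HeightOneSpectrum (𝓞 K)))) (classBarD K)

/-- Formula: the counit is `x ↦ x.1` on vectors. [cite: Harari2020, §17.1 Thm. 17.2] -/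
@[simp]
theorem classBarKSIncl_hom_hom_apply (z : (classBarKS K S).V) :
    (classBarKSIncl S).hom.hom z = (z.1 : classBar K) := rfl

omit [NumberField K] in
/-- `U_E ≤ π⁻¹(V̄_E)` (`π : Γ_K ↠ G_S`; indeed `V̄_E = π(U_E)`). [cite: SerreGaloisCohomology1997, I §2.2 Proposition 8] -/
theorem openNormalSubgroup_le_comap_layerSubgroupS (E : GalLayer K) :
    (E.openNormalSubgroup : Subgroup (absoluteGaloisGroup K)) ≤
      (layerSubgroupS S E : Subgroup (GaloisGroupUnramifiedOutside K (↑S : Set (HeightOneSpectrum (𝓞 K))))).comap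
        (QuotientGroup.mk' (ramificationSubgroup K (↑S : Set (HeightOneSpectrum (𝓞 K))))) :=
  fun _ hσ => mk_mem_layerSubgroupS S E hσ

/-- **The stage map of the layer `E`: `θ_E : Γ_K ⧸ U_E →* G_S ⧸ V̄_E`**, `[σ] ↦ [[σ]]`.
[cite: SerreGaloisCohomology1997, I §2.2 Proposition 8] -/
abbrev layerStageMap (E : GalLayer K) :
    absoluteGaloisGroup K ⧸ (E.openNormalSubgroup : Subgroup (absoluteGaloisGroup K)) →*
      GaloisGroupUnramifiedOutside K (↑S : Set (HeightOneSpectrum (𝓞 K))) ⧸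
        (layerSubgroupS S E : Subgroup (GaloisGroupUnramifiedOutside K (↑S : Set (HeightOneSpectrum (𝓞 K))))) :=
  stageMap (ramificationSubgroup K (↑S : Set (HeightOneSpectrum (𝓞 K))))
    (E.openNormalSubgroup : Subgroup (absoluteGaloisGroup K))
    (layerSubgroupS S E : Subgroup (GaloisGroupUnramifiedOutside K (↑S : Set (HeightOneSpectrum (𝓞 K)))))
    (openNormalSubgroup_le_comap_layerSubgroupS S E)

/-- **The coefficient map of the layer `E`: `ψ_E : res_θ (C_{K_S}^{V̄_E}) ⟶ C̄^{U_E}`**, `x ↦ x` (the stage inclusion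
followed by the counit on `U_E`-invariants). [cite: SerreGaloisCohomology1997, I §2.2 Proposition 8] -/
abbrev layerStageIncl (E : GalLayer K) :
    (Rep.resFunctor (layerStageMap S E)).obj (layerRepKS S E) ⟶ layerRep E :=
  stageInvariantsIncl (ramificationSubgroup K (↑S : Set (HeightOneSpectrum (𝓞 K))))
      (E.openNormalSubgroup : Subgroup (absoluteGaloisGroup K))
      (layerSubgroupS S E : Subgroup (GaloisGroupUnramifiedOutside K (↑S : Set (HeightOneSpectrum (𝓞 K)))))
      (openNormalSubgroup_le_comap_layerSubgroupS S E) (classBarKSD K S) ≫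
    (invariantsQuotFunctor ℤ (E.openNormalSubgroup : Subgroup (absoluteGaloisGroup K))).map (classBarKSIncl S)

/-- Formula: `ψ_E` is `x ↦ x.1.1` on vectors. [cite: SerreGaloisCohomology1997, I §2.2 Proposition 8] -/
@[simp]
theorem layerStageIncl_hom_apply_coe (E : GalLayer K) (z : (layerRepKS S E).V) :
    (((layerStageIncl S E).hom z).1 : classBar K) = (z.1.1 : classBar K) := rfl

section Layer

variable {E : GalLayer K} (hE : ramificationSubgroup K (↑S : Set (HeightOneSpectrum (𝓞 K))) ≤ galFixing K E.1)

/-- **The two homomorphisms `Gal(E/K) → G_S ⧸ V̄_E` agree: `θ_E ∘ quotEquiv_E⁻¹ = quotLayerSEquiv⁻¹`** (both send `σ|_E` to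
`[[σ]]`). [cite: SerreGaloisCohomology1997, I §2.2 Proposition 8] -/
theorem layerStageMap_comp_quotEquiv_symm :
    (layerStageMap S E).comp E.quotEquiv.symm.toMonoidHom = (quotLayerSEquiv S hE).symm.toMonoidHom := by
  haveI := E.isGalois
  refine MonoidHom.ext fun σ => ?_
  obtain ⟨τ, rfl⟩ := GalLayer.restrictHom_surjective E σ
  change layerStageMap S E (E.quotEquiv.symm (E.restrictHom τ)) = (quotLayerSEquiv S hE).symm (E.restrictHom τ)
  rw [MulEquiv.eq_symm_apply, GalLayer.restrictHom_apply, GalLayer.quotEquiv_symm_restrictNormal, stageMap_mk,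
    quotLayerSEquiv_mk_mk, GalLayer.restrictHom_apply]

/-- **The two module identifications agree: `layerEquiv_E (ψ_E z) = layerKSModuleEquiv z`** (both read off the element of
`C_E` whose image in `C̄` is the underlying vector of `z`). [cite: CasselsFrohlichANT1967, Ch. VII §8 Prop. 8.1] -/
theorem layerEquiv_layerStageIncl (z : (layerRepKS S E).V) :
    layerEquiv E ((layerStageIncl S E).hom z) = layerKSModuleEquiv S hE z := by
  obtain ⟨x, rfl⟩ := toLayerKS_surjective S hE z
  rw [layerKSModuleEquiv_toLayerKS, layerEquiv_eq_iff, layerStageIncl_hom_apply_coe, coe_toLayerKS, coe_toKS]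

/-- **The dictionaries commute with the pull-back: `H^n(θ_E, ψ_E) ≫ iso_E = isoKS_E`** as maps
`Hⁿ(G_S ⧸ V̄_E, C_{K_S}^{V̄_E}) → Hⁿ(Gal(E/K), C_E)` (both composites are `groupCohomology.map` along the same pair).
[cite: SerreGaloisCohomology1997, I §2.2 Proposition 8][cite: CasselsFrohlichANT1967, Ch. VII §11.2 (bis)] -/
theorem map_layerStage_comp_layerCohomologyIso (n : ℕ) :
    groupCohomology.map (layerStageMap S E) (layerStageIncl S E) n ≫ (layerCohomologyIso E n).hom =
      (layerKSCohomologyIso S hE n).hom := by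
  haveI := E.numberField
  haveI := E.isGalois
  rw [layerCohomologyIso, layerKSCohomologyIso, groupCohomology.mapIso_hom, groupCohomology.mapIso_hom,
    ← groupCohomology.map_comp]
  refine map_congr' (layerStageMap_comp_quotEquiv_symm S hE) _ _ (fun z => ?_) n
  change layerEquiv E ((layerStageIncl S E).hom z) = layerKSModuleEquiv S hE z
  exact layerEquiv_layerStageIncl S hE z

/-- Applied form: `iso_E (Hⁿ(θ_E, ψ_E) c) = isoKS_E c`. [cite: SerreGaloisCohomology1997, I §2.2 Proposition 8] -/
theorem layerCohomologyIso_hom_map_layerStage (n : ℕ) (c : groupCohomology (layerRepKS S E) n) :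
    (layerCohomologyIso E n).hom (groupCohomology.map (layerStageMap S E) (layerStageIncl S E) n c) =
      (layerKSCohomologyIso S hE n).hom c := by
  rw [← ModuleCat.comp_apply, map_layerStage_comp_layerCohomologyIso S hE n]

/-- **Layer form of (★2)**: `inv_K (Inf_{U_E} (H²(θ_E, ψ_E) c)) = inv_{E/K} (isoKS_E c) = layerInvKS c` for
`c ∈ H²(G_S ⧸ V̄_E, C_{K_S}^{V̄_E})`. [cite: CasselsFrohlichANT1967, Ch. VII §11.2 (bis)][cite: Harari2020, §16.1 Def. 16.3] -/
theorem classBarInv_inflG_map_layerStage (c : groupCohomology (layerRepKS S E) 2) :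
    classBarInv K (LayerColimit.inflG E.openNormalSubgroup (classBarD K) 2
        (groupCohomology.map (layerStageMap S E) (layerStageIncl S E) 2 c)) = layerInvKS S hE c := by
  rw [classBarInv_inflG, layerInv_apply, layerInvKS_apply, layerCohomologyIso_hom_map_layerStage S hE 2 c]

/-- **(★2) on a class inflated from the layer `E ⊂ K_S`**:
`inv_K (Inf_{N_S}(Inf_{V̄_E} c) ≫ incl) = layerInvKS c = inv_{K_S} (Inf_{V̄_E} c)`.
[cite: CasselsFrohlichANT1967, Ch. VII §11.2 (bis)][cite: Harari2020, §17.1 Thm. 17.2] -/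
theorem classBarInv_inflExtHomTriv_inflG_comp_mk₀ (c : groupCohomology (layerRepKS S E) 2) :
    classBarInv K ((inflExtHomTriv (ramificationSubgroup K (↑S : Set (HeightOneSpectrum (𝓞 K)))) (classBarKSD K S) 2
        (LayerColimit.inflG (layerSubgroupS S E) (classBarKSD K S) 2 c)).comp (Ext.mk₀ (classBarKSIncl S)) (add_zero 2)) =
      layerInvKS S hE c := by
  rw [LayerColimit.inflExtHomTriv_inflG_comp_mk₀' (ramificationSubgroup K (↑S : Set (HeightOneSpectrum (𝓞 K))))
    E.openNormalSubgroup (layerSubgroupS S E) (openNormalSubgroup_le_comap_layerSubgroupS S E) (classBarKSD K S)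
    (classBarKSIncl S) 2 c]
  exact classBarInv_inflG_map_layerStage S hE c

end Layer

/-! ## §2. (★2) `inv_{K_S} = inv_K ∘ (Inf_{N_S}(–) ≫ incl)` -/

/-- **(★2): `invKS S x = classBarInv K (Inf_{N_S}(x) ≫ incl)`** for every `x ∈ Ext²_{C_{G_S}}(ℤ, C_{K_S})` — the invariant
map of `(G_S, C_{K_S})` is the invariant map of `(Γ_K, C̄)` after inflation along `Γ_K ↠ G_S` and the counit
`C̄^{N_S} ⊆ C̄` (layer induction: `x` is inflated from some layer `E ⊂ K_S`, where both sides are `inv_{E/K}` of the same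
class). [cite: Harari2020, §17.1 Thm. 17.2][cite: CasselsFrohlichANT1967, Ch. VII §11.2 (bis)][cite: MilneADT2006, I §4 (p. 55)] -/
theorem invKS_eq_classBarInv_inflExtHomTriv
    (x : Abelian.Ext (triv (k := ℤ) (Γ := GaloisGroupUnramifiedOutside K (↑S : Set (HeightOneSpectrum (𝓞 K)))) ℤ)
      (classBarKSD K S) 2) :
    invKS S x =
      classBarInv K ((inflExtHomTriv (ramificationSubgroup K (↑S : Set (HeightOneSpectrum (𝓞 K)))) (classBarKSD K S) 2
        x).comp (Ext.mk₀ (classBarKSIncl S)) (add_zero 2)) := by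
  haveI := totallyDisconnectedSpace_GS S
  obtain ⟨E, c, rfl⟩ := (isCompatibleFamily_layerInvKS S).exists_inflG_eq x
  rw [invKS_inflG S E.2, classBarInv_inflExtHomTriv_inflG_comp_mk₀ S E.2 c]

/-- The same typed with `inflExtHom N_S (triv ℤ)` (Mathlib's `Ext.mapExactFunctor` along `inflQuotFunctor`; `inflExtHomTriv`
is it, retyped along `Inf (triv ℤ) = triv ℤ`). [cite: Harari2020, §17.1 Thm. 17.2] -/
theorem invKS_eq_classBarInv_inflExtHom
    (x : Abelian.Ext (triv (k := ℤ) (Γ := GaloisGroupUnramifiedOutside K (↑S : Set (HeightOneSpectrum (𝓞 K)))) ℤ)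
      (classBarKSD K S) 2) :
    invKS S x =
      classBarInv K ((inflExtHom (ramificationSubgroup K (↑S : Set (HeightOneSpectrum (𝓞 K)))) (triv ℤ) (classBarKSD K S) 2
        x).comp (Ext.mk₀ (classBarKSIncl S)) (add_zero 2)) :=
  invKS_eq_classBarInv_inflExtHomTriv S x

/-- **(★1) + (★2): `inv_S (x ∘ [C_{K_S} ↠ C̄_S]) = inv_K (Inf_{N_S}(x) ≫ incl)`** — on classes coming from `C_{K_S}` the
invariant map of the `S`-class formation `(G_S, C̄_S)` is the invariant map of `(Γ_K, C̄)` after inflation (with -w5's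
`invS_comp_mk₀_toClassBarSD`). [cite: Harari2020, §17.1 Thm. 17.2][cite: MilneADT2006, I §4 (p. 55)] -/
theorem invS_comp_mk₀_toClassBarSD_eq_classBarInv
    (x : Abelian.Ext (triv (k := ℤ) (Γ := GaloisGroupUnramifiedOutside K (↑S : Set (HeightOneSpectrum (𝓞 K)))) ℤ)
      (classBarKSD K S) 2) :
    invS S (x.comp (Ext.mk₀ (toClassBarSD K S)) (add_zero 2)) =
      classBarInv K ((inflExtHomTriv (ramificationSubgroup K (↑S : Set (HeightOneSpectrum (𝓞 K)))) (classBarKSD K S) 2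
        x).comp (Ext.mk₀ (classBarKSIncl S)) (add_zero 2)) := by
  rw [invS_comp_mk₀_toClassBarSD, invKS_eq_classBarInv_inflExtHomTriv]

end IdeleClassBar

end Literature.NumberTheory.GaloisRepresentations

end
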